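import Literature.Analysis.FluidPDE.OkamotoSakajoWunsch2008.SeparableBlowup
import HarnessLib

/-!
# The generalised Constantin–Lax–Majda / Okamoto–Sakajo–Wunsch equation on the circle WITH DISSIPATION
# `−νΛ^σ`: classical solutions, steady states, the `ω = νΦ` scaling — definitions in the tree's Fourier
# vocabulary (Ambrose–Lushnikov–Siegel–Silantyev 2024, §2)

HONEST FRAMING (cell ns-blowup GROUP B «PROFILE SEARCH», zone Z3 = SHEET-S¹, the viscous gCLM/OSW sheet on
the circle; human rulings D-0035/D-0074): **1-D MODEL (viscous gCLM/OSW), not Euler/NS.** Nothing in this file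
is a statement about Navier–Stokes. It contains NO named fact: only definitions with bodies (the printed
equation) and proved identities.

Analysis/FluidPDE definitions file, companion of `SeparableBlowup.lean` (the INVISCID OSW equation
`ω_t + a v ω_x − v_x ω = 0`, `v_x = Hω` on `ℝ/2πℤ`, Fourier side: `fourierEval`, `derivCoeff`, `hilbertCoeff`,
`velocityEval`, `ExpDecay`, `IsRealSeq`, `IsClassicalSolution a C T`). Source of the dissipative equation:
D. M. Ambrose, P. M. Lushnikov, M. Siegel, D. A. Silantyev, *Global existence and singularity formation for
the generalized Constantin–Lax–Majda equation with dissipation: the real line vs. periodic domains*,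
Nonlinearity **37** (2024) = arXiv:2207.07548 [AmbroseLushnikovSiegelSilantyev2024], eq. (1.1)/(2.1):

  `ω̃_t + a u ω̃_x = ω̃ H(ω̃) − ν Λ^σ ω̃`,  `u_x = H(ω̃)`,  `x ∈ 𝕊 = ℝ/2πℤ`,                                (D)

`Λ = (−∂ₓ²)^{1/2}` (multiplier `|k|`), `σ ≥ 0`, `ν > 0`; the mean `ω_av` of `ω̃` is conserved and `H`, `Λ^σ`
annihilate constants, so (D) for the full function `ω̃ = ω + ω_av` is their mean-zero form (2.2)
`ω_t + a u ω_x = ωH(ω) + ω_av H(ω) − Λ^σ ω` (§2: "By rescaling each of `t` and `ω̃`, we can eliminate `ν` …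
we therefore set `ν = 1`"). Same equation: Jeong–Kim 2020 (1.1) with `f = 0` and `σ = 2β`
[cite: JeongKim2020, eq. (1.1)]; Silantyev–Lushnikov–Siegel–Ambrose 2025 (1.1)
[cite: SilantyevLushnikovSiegelAmbrose2025, eq. (1.1)]; the inviscid part is [cite: OkamotoSakajoWunsch2008, eq. (3)]
(`ω H ω = v_x ω`, same sign conventions as `SeparableBlowup.lean`: `H(e^{ikx}) = −i sgn(k) e^{ikx}`, ALSS (2.4)
`Hω = −i(ω₊ − ω₋)`).

* `fracLapCoeff σ c` — the multiplier of `Λ^σ` on the mean-zero part: `|k|^σ c_k` (`k ≠ 0`), `0` at `k = 0`.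
* `IsDissipativeSolutionOn a ν σ C S` — classical solutions of (D) on the time set `S` (slices real-analytic
  and real; pointwise time derivative = `−a v ω_x + ω Hω − ν Λ^σ ω`); at `ν = 0` on `S = (−∞, T)` it IS the
  tree's `IsClassicalSolution a C T` (`isDissipativeSolutionOn_zero_iff`).
* `IsViscousSteadyState a ν σ c` — time-independent solutions: real-analytic real `c` with
  `−a v ω_x + ω Hω − ν Λ^σ ω = 0` pointwise. (The cell's Z3-S¹ object «ω = νΦ_∞, an exact non-trivial odd steady
  state of the viscous gCLM on 𝕋» — profile-eng-3, SHEET §7.6 — is, BY NAME, a `c ≠ 0` with `IsOddSeq c` and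
  `IsViscousSteadyState a ν 2 c`; nothing about its existence is asserted here.)
* PROVED: `Λ² = −∂ₓ²` on coefficients (`fracLapCoeff_two`); the `k = 0` mode of every term of (D) vanishes
  (mean conservation, ALSS §2); the SCALING `ω = νΦ` (ALSS §2's elimination of `ν`, time-independent part): if
  `Φ` is a steady state at `ν = 1` then `ν·Φ` is a steady state at viscosity `ν`, any `σ`, any `a`
  (`IsViscousSteadyState.smul_viscosity`) — the identity behind the cell's «Ω_ε/ε → Φ_∞» frame and behind
  Jeong–Kim 2020 Rem. 2.3's `O(ν)` branch; a steady state is a dissipative solution on every time set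
  (`IsViscousSteadyState.isDissipativeSolutionOn_const`).

## What is deliberately NOT here (and why)

NO named fact. In particular ALSS 2024 **Theorem 3.1** (`σ ≥ 1`, any `a`, any mean: mean-zero Wiener-algebra
data with `‖ω₀‖_{B₀} < (1−ϖ)/(4(|1+a|+|a|))` at `ν = 1` ⇒ a unique global solution in the Duchon–Robert class
`𝓑_ϖ⁰`, all modes decaying like `e^{−ϖt|k|}`, analytic for `t > 0`) and **Theorem 4.7** (small `L²` data,
`σ > 1`) are NOT typed: their printed solution is a fixed point of the Duhamel map (2.9) in `𝓑_ϖ⁰` resp. a mild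
`L²` solution, and rendering it as a classical solution in the sense below would assert more than print; a
faithful typing needs the Fourier-side Duhamel formulation (convolution sums), left to a seat with a consumer.
Also not typed: Jeong–Kim 2020 Thm 2 / Prop 2.6 (FORCED steady states), Schochet 1986, SLSA 2025's exact pole
solutions (`σ ∈ {0,1}`). No existence of any steady state is claimed. Nothing about Euler or Navier–Stokes.

## References

* D. M. Ambrose, P. M. Lushnikov, M. Siegel, D. A. Silantyev, Nonlinearity 37 (2024), doi:10.1088/1361-6544/ad140c
  = arXiv:2207.07548: (1.1), §2 (2.1)–(2.4), Thm 3.1 (p. 8), Thm 4.7 (held text `paper:arxiv-2207.07548`, chunks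
  5–8, 11). [AmbroseLushnikovSiegelSilantyev2024]
* I.-J. Jeong, S.-C. Kim, Nonlinearity 33 (2020) 6662, (1.1), Rem. 2.3. [JeongKim2020]
* D. A. Silantyev, P. M. Lushnikov, M. Siegel, D. M. Ambrose, Stud. Appl. Math. 155 (2025) = arXiv:2411.01891,
  (1.1). [SilantyevLushnikovSiegelAmbrose2025]
* H. Okamoto, T. Sakajo, M. Wunsch, Nonlinearity 21 (2008) 2447, eq. (3). [OkamotoSakajoWunsch2008]
-/

noncomputable section

open Filter Set
open scoped Topology

namespace Literature.Analysis.FluidPDE.OkamotoSakajoWunsch2008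

/-! ### The dissipation multiplier -/

/-- Fourier multiplier of `Λ^σ = (−∂ₓ²)^{σ/2}` acting on the mean-zero part of a function on the circle:
`(Λ^σ ω)^_k = |k|^σ ω̂_k` for `k ≠ 0` and `0` at `k = 0` (constants are annihilated; for `σ > 0` this is just
`|k|^σ ω̂_k`). [cite: AmbroseLushnikovSiegelSilantyev2024, §2.1 (2.3) (`e^{−t𝓛}`, multiplier `e^{−t|k|^σ}`)] -/
def fracLapCoeff (σ : ℝ) (c : ℤ → ℂ) (k : ℤ) : ℂ :=
  if k = 0 then 0 else (((|(k : ℝ)| ^ σ : ℝ) : ℂ)) * c k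

/-- Unfolding `fracLapCoeff`. [cite: AmbroseLushnikovSiegelSilantyev2024, §2.1 (2.3)] -/
theorem fracLapCoeff_def (σ : ℝ) (c : ℤ → ℂ) (k : ℤ) :
    fracLapCoeff σ c k = if k = 0 then 0 else (((|(k : ℝ)| ^ σ : ℝ) : ℂ)) * c k :=
  rfl

/-- `Λ^σ` annihilates the mean: the `k = 0` coefficient is `0`. [cite: AmbroseLushnikovSiegelSilantyev2024, §2 ("`Λ^σ(ω_av) = 0`")] -/
@[simp] theorem fracLapCoeff_zero_mode (σ : ℝ) (c : ℤ → ℂ) : fracLapCoeff σ c 0 = 0 := by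
  simp [fracLapCoeff]

/-- `H` annihilates the mean: the `k = 0` coefficient of `Hω` is `0`. [cite: AmbroseLushnikovSiegelSilantyev2024, §2 ("the periodic Hilbert transform of a constant function is equal to zero")] -/
@[simp] theorem hilbertCoeff_zero_mode (c : ℤ → ℂ) : hilbertCoeff c 0 = 0 := by
  simp [hilbertCoeff, hilbertSymbol]

/-- `∂ₓ` annihilates the mean: the `k = 0` coefficient of `ω_x` is `0`. [cite: AmbroseLushnikovSiegelSilantyev2024, §2 ("`(ω_av)_x = 0`")] -/
@[simp] theorem derivCoeff_zero_mode (c : ℤ → ℂ) : derivCoeff c 0 = 0 := by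
  simp [derivCoeff]

/-- `Λ² = −∂ₓ²` on Fourier coefficients: `|k|² c_k = −(ik)(ik)c_k` (and both sides vanish at `k = 0`), i.e.
`σ = 2` is the full viscosity `−νω_xx` of Jeong–Kim's `β = 1` / Chen 2020 / Schochet.
[cite: AmbroseLushnikovSiegelSilantyev2024, §1 ("`σ = 2` … classical diffusion")] -/
theorem fracLapCoeff_two (c : ℤ → ℂ) (k : ℤ) :
    fracLapCoeff 2 c k = -derivCoeff (derivCoeff c) k := by
  by_cases hk : k = 0
  · subst hk; simp [fracLapCoeff, derivCoeff]
  · simp only [fracLapCoeff, hk, if_false, derivCoeff]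
    have h2 : (|(k : ℝ)| ^ (2 : ℝ) : ℝ) = (k : ℝ) ^ 2 := by
      rw [Real.rpow_two, sq_abs]
    rw [h2]
    push_cast
    have hI : Complex.I * Complex.I = -1 := Complex.I_mul_I
    linear_combination ((↑k : ℂ) ^ 2 * c k) * hI

/-! ### Classical solutions and steady states of the dissipative equation -/

/-- A CLASSICAL SOLUTION of the dissipative OSW/gCLM equation (D)
`ω̃_t + a v ω̃_x = ω̃ H(ω̃) − ν Λ^σ ω̃`, `v_x = H(ω̃)` on the circle, on the time set `S`
[cite: AmbroseLushnikovSiegelSilantyev2024, eq. (1.1) and (2.1)], slice-wise by Fourier coefficients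
`C t : ℤ → ℂ` of the FULL function `ω̃ = ω + ω_av` (the mean is the `k = 0` coefficient): every slice
`t ∈ S` is real and real-analytic, and at every `x` and `t ∈ S` the time derivative of `t ↦ ω̃(x,t)` exists and
equals `−a v ω̃_x + ω̃ H ω̃ − ν Λ^σ ω̃` at `(x,t)` (conventions of `SeparableBlowup.lean`). -/
def IsDissipativeSolutionOn (a ν σ : ℝ) (C : ℝ → ℤ → ℂ) (S : Set ℝ) : Prop :=
  (∀ t ∈ S, (∃ ρ K : ℝ, ExpDecay (C t) ρ K) ∧ IsRealSeq (C t)) ∧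
  ∀ (x : ℝ), ∀ t ∈ S,
    HasDerivAt (fun s : ℝ => fourierEval (C s) x)
      (-(a : ℂ) * velocityEval (C t) x * fourierEval (derivCoeff (C t)) x
        + fourierEval (C t) x * fourierEval (hilbertCoeff (C t)) x
        - (ν : ℂ) * fourierEval (fracLapCoeff σ (C t)) x) t

/-- A STEADY STATE of (D) with parameter `a`, viscosity `ν` and dissipation order `σ`: a real, real-analytic
coefficient sequence `c` with `−a v ω_x + ω Hω − ν Λ^σ ω = 0` at every point of the circle
[cite: AmbroseLushnikovSiegelSilantyev2024, eq. (2.1) (time-independent solutions)] (the unforced case `f = 0`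
of the stationary equation [cite: JeongKim2020, eq. (2.1)]). -/
def IsViscousSteadyState (a ν σ : ℝ) (c : ℤ → ℂ) : Prop :=
  (∃ ρ K : ℝ, ExpDecay c ρ K) ∧ IsRealSeq c ∧
  ∀ x : ℝ,
    -(a : ℂ) * velocityEval c x * fourierEval (derivCoeff c) x
      + fourierEval c x * fourierEval (hilbertCoeff c) x
      - (ν : ℂ) * fourierEval (fracLapCoeff σ c) x = 0

/-- At `ν = 0` and on the time set `(−∞, T)` the dissipative notion IS the tree's inviscid
`IsClassicalSolution a C T` of [cite: OkamotoSakajoWunsch2008, eq. (3)]. -/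
theorem isDissipativeSolutionOn_zero_iff (a σ : ℝ) (C : ℝ → ℤ → ℂ) (T : ℝ) :
    IsDissipativeSolutionOn a 0 σ C (Iio T) ↔ IsClassicalSolution a C T := by
  simp only [IsDissipativeSolutionOn, IsClassicalSolution, mem_Iio, Complex.ofReal_zero, zero_mul,
    sub_zero]

/-- A steady state, viewed as a time-independent family, is a classical solution of (D) on every time set.
[cite: AmbroseLushnikovSiegelSilantyev2024, eq. (2.1)] -/
theorem IsViscousSteadyState.isDissipativeSolutionOn_const {a ν σ : ℝ} {c : ℤ → ℂ}
    (h : IsViscousSteadyState a ν σ c) (S : Set ℝ) :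
    IsDissipativeSolutionOn a ν σ (fun _ => c) S := by
  obtain ⟨hdec, hreal, heq⟩ := h
  refine ⟨fun t _ => ⟨hdec, hreal⟩, fun x t _ => ?_⟩
  rw [heq x]
  exact hasDerivAt_const t (fourierEval c x)

/-! ### Scalar multiples on the Fourier side and the `ω = νΦ` scaling -/

/-- `Σ (r c_k) e^{ikx} = r Σ c_k e^{ikx}`. [cite: AmbroseLushnikovSiegelSilantyev2024, §2 (rescaling of `ω̃`)] -/
theorem fourierEval_const_mul (r : ℂ) (c : ℤ → ℂ) (x : ℝ) :
    fourierEval (fun k => r * c k) x = r * fourierEval c x := by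
  unfold fourierEval
  rw [← tsum_mul_left]
  refine tsum_congr fun k => ?_
  ring

/-- `(r c)_x = r c_x` coefficientwise. [cite: AmbroseLushnikovSiegelSilantyev2024, §2] -/
theorem derivCoeff_const_mul (r : ℂ) (c : ℤ → ℂ) :
    derivCoeff (fun k => r * c k) = fun k => r * derivCoeff c k := by
  funext k; simp only [derivCoeff]; ring

/-- `H(r c) = r Hc` coefficientwise. [cite: AmbroseLushnikovSiegelSilantyev2024, §2] -/
theorem hilbertCoeff_const_mul (r : ℂ) (c : ℤ → ℂ) :
    hilbertCoeff (fun k => r * c k) = fun k => r * hilbertCoeff c k := by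
  funext k; simp only [hilbertCoeff]; ring

/-- `Λ^σ(r c) = r Λ^σ c` coefficientwise. [cite: AmbroseLushnikovSiegelSilantyev2024, §2] -/
theorem fracLapCoeff_const_mul (σ : ℝ) (r : ℂ) (c : ℤ → ℂ) :
    fracLapCoeff σ (fun k => r * c k) = fun k => r * fracLapCoeff σ c k := by
  funext k
  by_cases hk : k = 0
  · simp [fracLapCoeff, hk]
  · simp only [fracLapCoeff, hk, if_false]; ring

/-- `v[r c] = r v[c]`. [cite: AmbroseLushnikovSiegelSilantyev2024, §2] -/
theorem velocityEval_const_mul (r : ℂ) (c : ℤ → ℂ) (x : ℝ) :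
    velocityEval (fun k => r * c k) x = r * velocityEval c x := by
  unfold velocityEval
  rw [← tsum_mul_left]
  refine tsum_congr fun k => ?_
  simp only [hilbertCoeff]
  ring

/-- Real-analyticity is preserved by scalar multiplication. [cite: AmbroseLushnikovSiegelSilantyev2024, §2] -/
theorem ExpDecay.const_mul {c : ℤ → ℂ} {ρ K : ℝ} (h : ExpDecay c ρ K) (r : ℂ) :
    ExpDecay (fun k => r * c k) ρ (‖r‖ * K) := by
  refine ⟨h.1, fun k => ?_⟩
  rw [norm_mul, mul_assoc]
  exact mul_le_mul_of_nonneg_left (h.2 k) (norm_nonneg r)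

/-- Reality is preserved by REAL scalar multiplication. [cite: AmbroseLushnikovSiegelSilantyev2024, §2] -/
theorem IsRealSeq.real_mul {c : ℤ → ℂ} (h : IsRealSeq c) (r : ℝ) :
    IsRealSeq (fun k => (r : ℂ) * c k) := by
  intro k
  simp only [h k, map_mul, Complex.conj_ofReal]

/-- **The `ω = νΦ` scaling** (ALSS §2: "By rescaling each of `t` and `ω̃`, we can eliminate `ν`"; its
time-independent part): if `Φ` (coefficients `c`) is a steady state of (D) at viscosity `1`, then `ν·Φ` is a
steady state at viscosity `ν` — for every `a`, every `σ` and every real `ν` (both the quadratic terms and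
`νΛ^σ(νΦ)` scale by `ν²`). This is the identity that makes a large-viscosity steady branch growing like `O(ν)`
(Jeong–Kim 2020, Rem. 2.3, `a = 1/2`) the same object as a `ν = 1` steady state, and the cell's frozen-`ε` limit
«`Ω_ε/ε → Φ_∞`» on SHEET-S¹. [cite: AmbroseLushnikovSiegelSilantyev2024, §2 (elimination of `ν`)] -/
theorem IsViscousSteadyState.smul_viscosity {a σ : ℝ} {c : ℤ → ℂ} (h : IsViscousSteadyState a 1 σ c)
    (ν : ℝ) : IsViscousSteadyState a ν σ (fun k => (ν : ℂ) * c k) := by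
  obtain ⟨⟨ρ, K, hdec⟩, hreal, heq⟩ := h
  refine ⟨⟨ρ, ‖(ν : ℂ)‖ * K, hdec.const_mul (ν : ℂ)⟩, hreal.real_mul ν, fun x => ?_⟩
  have hx := heq x
  rw [derivCoeff_const_mul, hilbertCoeff_const_mul, fracLapCoeff_const_mul, velocityEval_const_mul,
    fourierEval_const_mul, fourierEval_const_mul, fourierEval_const_mul, fourierEval_const_mul]
  simp only [Complex.ofReal_one, one_mul] at hx
  have : -(a : ℂ) * ((ν : ℂ) * velocityEval c x) * ((ν : ℂ) * fourierEval (derivCoeff c) x) +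
      (ν : ℂ) * fourierEval c x * ((ν : ℂ) * fourierEval (hilbertCoeff c) x) -
      (ν : ℂ) * ((ν : ℂ) * fourierEval (fracLapCoeff σ c) x) =
      (ν : ℂ) ^ 2 * (-(a : ℂ) * velocityEval c x * fourierEval (derivCoeff c) x +
        fourierEval c x * fourierEval (hilbertCoeff c) x - fourierEval (fracLapCoeff σ c) x) := by
    ring
  rw [this, hx, mul_zero]

/-- Conversely-shaped bookkeeping for consumers: a steady state at viscosity `ν ≠ 0` rescales to one at
viscosity `1` (`Φ = ω/ν`). [cite: AmbroseLushnikovSiegelSilantyev2024, §2 (elimination of `ν`)] -/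
theorem IsViscousSteadyState.smul_viscosity_inv {a ν σ : ℝ} {c : ℤ → ℂ} (hν : ν ≠ 0)
    (h : IsViscousSteadyState a ν σ c) : IsViscousSteadyState a 1 σ (fun k => ((ν⁻¹ : ℝ) : ℂ) * c k) := by
  obtain ⟨⟨ρ, K, hdec⟩, hreal, heq⟩ := h
  refine ⟨⟨ρ, ‖((ν⁻¹ : ℝ) : ℂ)‖ * K, hdec.const_mul _⟩, hreal.real_mul ν⁻¹, fun x => ?_⟩
  have hx := heq x
  rw [derivCoeff_const_mul, hilbertCoeff_const_mul, fracLapCoeff_const_mul, velocityEval_const_mul,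
    fourierEval_const_mul, fourierEval_const_mul, fourierEval_const_mul, fourierEval_const_mul]
  have hνC : (ν : ℂ) ≠ 0 := Complex.ofReal_ne_zero.2 hν
  have hinv : ((ν⁻¹ : ℝ) : ℂ) = (ν : ℂ)⁻¹ := Complex.ofReal_inv ν
  rw [hinv]
  have : -(a : ℂ) * ((ν : ℂ)⁻¹ * velocityEval c x) * ((ν : ℂ)⁻¹ * fourierEval (derivCoeff c) x) +
      (ν : ℂ)⁻¹ * fourierEval c x * ((ν : ℂ)⁻¹ * fourierEval (hilbertCoeff c) x) -
      (1 : ℂ) * ((ν : ℂ)⁻¹ * fourierEval (fracLapCoeff σ c) x) =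
      (ν : ℂ)⁻¹ ^ 2 * (-(a : ℂ) * velocityEval c x * fourierEval (derivCoeff c) x +
        fourierEval c x * fourierEval (hilbertCoeff c) x -
        (ν : ℂ) * fourierEval (fracLapCoeff σ c) x) := by
    field_simp
  rw [Complex.ofReal_one, this, hx, mul_zero]

end Literature.Analysis.FluidPDE.OkamotoSakajoWunsch2008
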